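import Summits.ABC.ABC.Theorems.IsogenyGlueCongruencePolyDegreeOfBoundedPrimesHeightCalibration
import Summits.ABC.ABC.Theorems.IsogenyGlueCongruencePolyDegreeOfBoundedPrimesHeightCalibrationManin
import Literature.NumberTheory.EllipticCurves.SzpiroFreyProofs
import Literature.NumberTheory.EllipticCurves.SzpiroFreyCurveProofs
import Literature.NumberTheory.EllipticCurves.SzpiroOfAbcProofs
import Literature.NumberTheory.EllipticCurves.DegreeConjectureAbcPrelims
import Literature.NumberTheory.DiophantineGeometry.LocalReductionProofs

/-!
# Exact height calibration of crux B (`PolyDegreeOfBoundedPrimes`, stmt-ABC-2046, line `Sketch`): `P ↔ H ∧ M`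

Two-line corollaries of `IsogenyGlueCongruencePolyDegreeOfBoundedPrimesHeightCalibration` (p102896: `P → H`,
`H ∧ M → P`) and `…HeightCalibrationManin` (`P → M`), same notation (`P` = consequent of crux B, `H` = polynomial
height conjecture for semistable globally minimal `W/ℚ` in `max(|Δ|,|c₄|³)` form, `M` = polynomially bounded Manin
constant for some datum): `polyDegree_iff_polyHeight_and_manin` — **`P ↔ H ∧ M`**;
`polyDegreeOfBoundedPrimes_iff_height_and_manin` (registered sub-goal of stmt-ABC-2046) — **`B ↔ (A → H ∧ M)`**.
Hypothesis-free. Riders: `polyAbcNormalized_of_polyHeight` — what `H` buys for abc over the tree's PROVED Frey-curve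
facts: on the global minimal model `freyIntModel₂ A B ⊗ ℚ` (Bombieri–Gubler (12.18); minimal by
`isMinimalAt_freyIntModel₂`, semistable with the Frey curve's conductor `N = rad(AB(A+B))`) of a Serre-normalised
pair (`A ≡ −1 (mod 4)`, `32 ∣ B`), `Δ = (AB/16)²(A+B)²`, so `H` gives `(AB(A+B))² ≤ 2⁸·C·N^σ` — polynomial abc
on normalised triples; and `polyAbcNormalized_of_polyDegreeOfBoundedPrimes` (`B → A →` the same).
Remark (support item stmt-ABC-2048 `PolyAbcOfPolyDegree`: `P → BakerShapeBound 0 1` for ALL triples): reducing a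
general coprime triple to a normalised one through `(u⁸, v⁸ − u⁸, v⁸)` multiplies the radical by up to `c⁷` while
`c' ≥ (c/2)⁸`, so `c' ≤ K·rad'^θ` transfers only for `θ < 8/7` — fine for the sharp `1+ε` forms (Assembly2),
useless for the unspecified exponent `σ/2` coming from `H`/`P`; the normalised statement here is what does follow.
Also `polyHeight_of_generalizedSzpiroBG` (`GeneralizedSzpiroConjectureBG → H`, the catalogued `@[conjecture]` of Szpiro.lean) and
`polyDegreeOfBoundedPrimes_of_generalizedSzpiroBG_of_manin` (`GeneralizedSzpiroConjectureBG → M → B`). Supports stmt-ABC-2046.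
-/

noncomputable section

-- single-conjunct summit ABC: the duplicate ABC.ABC is mandated (CONVENTIONS §2)
set_option linter.dupNamespace false

namespace Summit.ABC.ABC.Theorems

open IsDedekindDomain WeierstrassCurve
open Literature.NumberTheory.DiophantineGeometry Literature.NumberTheory.EllipticCurves
open Literature.NumberTheory.EllipticCurves.ModularForms
open Summit.ABC.ABC.Theses.IsogenyGlueCongruence

/-- **Exact calibration of the consequent: `P ↔ H ∧ M`.** The polynomial modular-degree statement for
semistable curves is EQUIVALENT to the conjunction of the polynomial height conjecture `H` and the
polynomial Manin bound `M` (`→`: `polyHeight_of_polyDegree` and `manin_of_polyDegree`; `←`: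
`polyDegree_of_polyHeight_of_manin`). Unconditional; no side hypothesis. [folklore] -/
theorem polyDegree_iff_polyHeight_and_manin :
    (∃ κ C : ℝ, ∀ (W : WeierstrassCurve ℚ) [W.IsElliptic] [W.IsGloballyMinimal]
      [NeZero (W.conductorNorm ℤ)], W.IsSemistable ℤ →
      ∃ D : ModularParametrizationData W (W.conductorNorm ℤ),
        (D.modularDegree : ℝ) ≤ C * (W.conductorNorm ℤ : ℝ) ^ κ) ↔
    ((∃ σ C : ℝ, ∀ (W : WeierstrassCurve ℚ) [W.IsElliptic] [W.IsGloballyMinimal]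
      [NeZero (W.conductorNorm ℤ)], W.IsSemistable ℤ →
      ((max |W.Δ| (|W.c₄| ^ 3) : ℚ) : ℝ) ≤ C * (W.conductorNorm ℤ : ℝ) ^ σ) ∧
    (∃ a M₀ : ℝ, ∀ (W : WeierstrassCurve ℚ) [W.IsElliptic] [W.IsGloballyMinimal]
      [NeZero (W.conductorNorm ℤ)], W.IsSemistable ℤ →
      ∃ D : ModularParametrizationData W (W.conductorNorm ℤ),
        |(D.maninConstant : ℝ)| ≤ M₀ * (W.conductorNorm ℤ : ℝ) ^ a)) :=
  ⟨fun hP ↦ ⟨polyHeight_of_polyDegree hP, manin_of_polyDegree hP⟩,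
    fun h ↦ polyDegree_of_polyHeight_of_manin h.1 h.2⟩

/-- **Exact calibration of crux B: `B ↔ (A → H ∧ M)`**, unconditionally. Crux B says precisely that crux A
implies the polynomial height conjecture for semistable curves together with the polynomial Manin bound;
since `M` is a theorem in print (Česnavičius 2018 + Kenku 1982, exponent `0`), B is in substance
"A ⟹ polynomial Szpiro (height form) for semistable curves". [folklore] -/
theorem polyDegreeOfBoundedPrimes_iff_height_and_manin : Summit.ABC.ABC.Theses.IsogenyGlueCongruence.PolyDegreeOfBoundedPrimes ↔ (Summit.ABC.ABC.Theses.IsogenyGlueCongruence.DegreePrimesPolyBounded → (∃ σ C : ℝ, ∀ (W : WeierstrassCurve ℚ) [W.IsElliptic] [W.IsGloballyMinimal] [NeZero (W.conductorNorm ℤ)], W.IsSemistable ℤ → ((max |W.Δ| (|W.c₄| ^ 3) : ℚ) : ℝ) ≤ C * (W.conductorNorm ℤ : ℝ) ^ σ) ∧ (∃ a M₀ : ℝ, ∀ (W : WeierstrassCurve ℚ) [W.IsElliptic] [W.IsGloballyMinimal] [NeZero (W.conductorNorm ℤ)], W.IsSemistable ℤ → ∃ D : Literature.NumberTheory.EllipticCurves.ModularForms.ModularParametrizationData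 W (W.conductorNorm ℤ), |(D.maninConstant : ℝ)| ≤ M₀ * (W.conductorNorm ℤ : ℝ) ^ a)) :=
  ⟨fun hB hA ↦ polyDegree_iff_polyHeight_and_manin.mp (hB hA),
    fun h hA ↦ polyDegree_iff_polyHeight_and_manin.mpr (h hA)⟩

/-! ## `H` from the catalogued generalized Szpiro conjecture -/

/-- **`GeneralizedSzpiroConjectureBG → H`**: the catalogued generalized Szpiro conjecture of Bombieri–Gubler
(`max(|Δ|, |c₄|³) ≤ C(ε)·N^{6+ε}` for every elliptic curve over `ℚ` in global minimal form; `@[conjecture]`,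
`Literature.NumberTheory.EllipticCurves.GeneralizedSzpiroConjectureBG`, equivalent to the `≤`-form of abc by the
tree theorem `abcLe_iff_generalizedSzpiroBG_holds`) implies the polynomial height statement `H` (σ = 7), read on
the integral global minimal model `integralModelInt W`. [folklore] -/
theorem polyHeight_of_generalizedSzpiroBG (h : GeneralizedSzpiroConjectureBG) :
    ∃ σ C : ℝ, ∀ (W : WeierstrassCurve ℚ) [W.IsElliptic] [W.IsGloballyMinimal]
      [NeZero (W.conductorNorm ℤ)], W.IsSemistable ℤ →
      ((max |W.Δ| (|W.c₄| ^ 3) : ℚ) : ℝ) ≤ C * (W.conductorNorm ℤ : ℝ) ^ σ := by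
  obtain ⟨C, hC⟩ := h 1 one_pos
  refine ⟨6 + 1, C, fun W _ _ _ _ ↦ ?_⟩
  set W₀ : WeierstrassCurve ℤ := integralModelInt W with hW₀def
  have hW₀ : W₀.baseChange ℚ = W := baseChange_integralModelInt W
  have hell : (W₀.baseChange ℚ).IsElliptic := by rw [hW₀]; infer_instance
  have hmin : ∀ v : HeightOneSpectrum ℤ, (W₀.baseChange ℚ).IsMinimalAt v := fun v ↦ by
    rw [hW₀]; exact IsGloballyMinimal.isMinimalAt_int W v
  have hσ := hC W₀ hell hmin
  rw [hW₀] at hσ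
  have hq : (max |W.Δ| (|W.c₄| ^ 3) : ℚ) = ((max |W₀.Δ| (|W₀.c₄| ^ 3) : ℤ) : ℚ) := by
    rw [← cast_integralModelInt_Δ W, ← cast_integralModelInt_c₄ W]
    push_cast
    rfl
  rw [hq, Rat.cast_intCast]
  exact hσ


/-- **`GeneralizedSzpiroConjectureBG → M → B`**: crux B conditional on the catalogued Bombieri–Gubler generalized
Szpiro conjecture (equivalently, by `abcLe_iff_generalizedSzpiroBG_holds`, on the `≤`-form of abc) and the
polynomial Manin bound — the conditional-bridge form of the calibration, through an EXISTING Literature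
conjecture. [folklore] -/
theorem polyDegreeOfBoundedPrimes_of_generalizedSzpiroBG_of_manin (h : GeneralizedSzpiroConjectureBG)
    (hM : ∃ a M₀ : ℝ, ∀ (W : WeierstrassCurve ℚ) [W.IsElliptic] [W.IsGloballyMinimal]
      [NeZero (W.conductorNorm ℤ)], W.IsSemistable ℤ →
      ∃ D : ModularParametrizationData W (W.conductorNorm ℤ),
        |(D.maninConstant : ℝ)| ≤ M₀ * (W.conductorNorm ℤ : ℝ) ^ a) :
    PolyDegreeOfBoundedPrimes :=
  polyDegreeOfBoundedPrimes_of_polyHeight_of_manin (polyHeight_of_generalizedSzpiroBG h) hM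

/-! ## What `H` buys: polynomial abc on Serre-normalised triples -/

/-- **`H →` polynomial abc on Serre-normalised triples.** If `max(|Δ_W|, |c₄(W)|³) ≤ C·N_W^σ` for every
semistable globally minimal elliptic `W/ℚ`, then `(AB(A+B))² ≤ 2⁸·max(C,0)·N^σ` for all coprime `A, B` with
`AB(A+B) ≠ 0`, `A ≡ −1 (mod 4)`, `32 ∣ B`, where `N` is the conductor of the Frey curve `freyCurve A B`
(`= rad(AB(A+B))`, `conductorNorm_freyCurve_of_mod_holds`). Proof: apply `H` to the global minimal model
`freyIntModel₂ A B ⊗ ℚ` (minimal: `isMinimalAt_freyIntModel₂`; semistable and of the same conductor as the Frey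
curve: `isSemistable_freyCurve_of_mod_holds`, `isSemistable_smul_iff_holds`, `conductorNorm_smul_rat`), whose
discriminant is `(AB/16)²(A+B)²` (`freyIntModel₂_Δ`). [cite: BombieriGubler2006, Ex. 12.5.10] -/
theorem polyAbcNormalized_of_polyHeight
    (hH : ∃ σ C : ℝ, ∀ (W : WeierstrassCurve ℚ) [W.IsElliptic] [W.IsGloballyMinimal]
      [NeZero (W.conductorNorm ℤ)], W.IsSemistable ℤ →
      ((max |W.Δ| (|W.c₄| ^ 3) : ℚ) : ℝ) ≤ C * (W.conductorNorm ℤ : ℝ) ^ σ) :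
    ∃ σ C : ℝ, ∀ A B : ℤ, IsCoprime A B → A * B * (A + B) ≠ 0 → A ≡ -1 [ZMOD 4] → (32 : ℤ) ∣ B →
      (((A * B * (A + B)) ^ 2 : ℤ) : ℝ) ≤ C * ((freyCurve A B).conductorNorm ℤ : ℝ) ^ σ := by
  obtain ⟨σ, C, hH⟩ := hH
  refine ⟨σ, 256 * max C 0, fun A B hAB h0 hA hB ↦ ?_⟩
  -- Serre's normalisation, in the divisibility forms the tree lemmas take
  have hA4 : 4 ∣ A + 1 := by
    have h := Int.modEq_iff_dvd.mp hA
    have : A + 1 = -(-1 - A) := by ring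
    rw [this]; exact (dvd_neg).mpr h
  have hB16 : (16 : ℤ) ∣ B := dvd_trans (by norm_num) hB
  have h4 : 4 ∣ B - A - 1 := by
    have : B - A - 1 = B - (A + 1) := by ring
    rw [this]; exact dvd_sub (dvd_trans (by norm_num) hB16) hA4
  have h16' : 16 ∣ A * B := dvd_mul_of_dvd_right hB16 _
  haveI := isElliptic_freyCurve h0
  haveI := isElliptic_freyIntModel₂ h0 h4 h16'
  haveI : ((freyIntModel₂ A B).baseChange ℚ).IsGloballyMinimal :=
    isGloballyMinimal_of_forall_isMinimalAt_int _ (isMinimalAt_freyIntModel₂ hAB hA4 hB16)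
  -- the minimal model has the conductor of the Frey curve and is semistable
  have hCW := smul_freyCurve_eq_baseChange_freyIntModel₂ h4 h16'
  have hcond : ((freyIntModel₂ A B).baseChange ℚ).conductorNorm ℤ =
      (freyCurve A B).conductorNorm ℤ := by
    rw [← hCW, WeierstrassCurve.conductorNorm_smul_rat]
  haveI : NeZero (((freyIntModel₂ A B).baseChange ℚ).conductorNorm ℤ) :=
    ⟨(conductorNorm_pos_holds _).ne'⟩
  have hss : ((freyIntModel₂ A B).baseChange ℚ).IsSemistable ℤ := by
    rw [← hCW]
    exact (WeierstrassCurve.isSemistable_smul_iff_holds ℤ (freyCurve A B) _).mpr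
      (isSemistable_freyCurve_of_mod_holds A B hAB h0 hA hB)
  -- apply `H`
  have hmain := hH ((freyIntModel₂ A B).baseChange ℚ) hss
  rw [hcond] at hmain
  -- the discriminant of the minimal model
  obtain ⟨w, hw⟩ := h16'
  have hw' : A * B / 16 = w := by rw [hw]; simp
  have hΔq : ((freyIntModel₂ A B).baseChange ℚ).Δ = (((freyIntModel₂ A B).Δ : ℤ) : ℚ) := by
    simp [WeierstrassCurve.baseChange, WeierstrassCurve.map_Δ]
  have hΔeq : (freyIntModel₂ A B).Δ = w ^ 2 * (A + B) ^ 2 := by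
    rw [freyIntModel₂_Δ h4 ⟨w, hw⟩, hw']
  have hsq : (A * B * (A + B)) ^ 2 = 256 * (w ^ 2 * (A + B) ^ 2) := by rw [hw]; ring
  -- `w²(A+B)² = |Δ| ≤ max(|Δ|,|c₄|³) ≤ C N^σ ≤ max C 0 · N^σ`
  have hN0 : (0 : ℝ) ≤ ((freyCurve A B).conductorNorm ℤ : ℝ) ^ σ := by positivity
  have h1 : ((w ^ 2 * (A + B) ^ 2 : ℤ) : ℝ) ≤ max C 0 * ((freyCurve A B).conductorNorm ℤ : ℝ) ^ σ := by
    have habs : |((freyIntModel₂ A B).baseChange ℚ).Δ| = ((w ^ 2 * (A + B) ^ 2 : ℤ) : ℚ) := by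
      rw [hΔq, hΔeq, abs_of_nonneg]
      positivity
    have e1 : (((w ^ 2 * (A + B) ^ 2 : ℤ) : ℚ) : ℝ) ≤
        ((max |((freyIntModel₂ A B).baseChange ℚ).Δ|
          (|((freyIntModel₂ A B).baseChange ℚ).c₄| ^ 3) : ℚ) : ℝ) := by
      rw [← habs]; exact_mod_cast le_max_left _ _
    have e2 : (((w ^ 2 * (A + B) ^ 2 : ℤ) : ℚ) : ℝ) = ((w ^ 2 * (A + B) ^ 2 : ℤ) : ℝ) := by
      push_cast; ring
    rw [← e2]
    exact (e1.trans hmain).trans (mul_le_mul_of_nonneg_right (le_max_left _ _) hN0)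
  calc (((A * B * (A + B)) ^ 2 : ℤ) : ℝ) = 256 * ((w ^ 2 * (A + B) ^ 2 : ℤ) : ℝ) := by
        rw [hsq]; push_cast; ring
    _ ≤ 256 * (max C 0 * ((freyCurve A B).conductorNorm ℤ : ℝ) ^ σ) :=
        mul_le_mul_of_nonneg_left h1 (by norm_num)
    _ = 256 * max C 0 * ((freyCurve A B).conductorNorm ℤ : ℝ) ^ σ := by ring


/-- **`B → A →` polynomial abc on Serre-normalised triples** (composition of the crux with `P → H`,
`polyHeight_of_polyDegree`, p102896, and `polyAbcNormalized_of_polyHeight`): what crux B buys for abc,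
granted crux A. [folklore] -/
theorem polyAbcNormalized_of_polyDegreeOfBoundedPrimes (hB : PolyDegreeOfBoundedPrimes)
    (hA : DegreePrimesPolyBounded) :
    ∃ σ C : ℝ, ∀ A B : ℤ, IsCoprime A B → A * B * (A + B) ≠ 0 → A ≡ -1 [ZMOD 4] → (32 : ℤ) ∣ B →
      (((A * B * (A + B)) ^ 2 : ℤ) : ℝ) ≤ C * ((freyCurve A B).conductorNorm ℤ : ℝ) ^ σ :=
  polyAbcNormalized_of_polyHeight (polyHeight_of_polyDegree (hB hA))

end Summit.ABC.ABC.Theorems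

end
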